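import Mathlib
import Summits.ResolutionOfSingularities.ResolutionOfSingularities.Theorems.RadicialJungCleanModelsLens5TFrameSepDeg
import HarnessLib

/-!
# Route `RadicialJung`, crux `CleanModels` (stmt-15917): T″ port part 3/10 — §D∞ PORT 1′_∞ `port_gradedDataInf` (doubly graded data for an arbitrary residually `p`-independent `p`-spanning family)

PORT (line lead `res-B-lead-1` g8, for Sketch rev 33) of res-B-lens-5's crux workfiles `Cruxes/DescentPerfectToAll/Lens5_TPrimeInfCurrency.lean` rev 4
(crux 75ffdaa75b27; author res-B-lens-5 g14), the T″ theorem module prepared by the author from `Lens5_TPrimeInf.lean` rev 3 (HOME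
`B/res-B-lens-5/g14/PORTALPHA_TPrimeInf_theorem_module.lean`, sha16 48c5cb0bf6ec7b34, certified by the author's one-file simulation) and
`Cruxes/DescentPerfectToAll/Lens5_TPrimeConst.lean` rev 1 (4e5e6a0028c2): THEOREMS T′_∞ / T″ / T‴ — the slice {`[Γ:pΓ] = p²`, `K/k′` separably
generated and `κ_v/k′` SEPARABLE for some finite intermediate field of constants `k ⊆ k′ ⊆ K`} of the research stub `stub_cleanLU3DefectNonDiscrete`
(grounds of ARBITRARY, possibly infinite, `p`-rank), modulo F-02 `CossartPiltant2019` and F-32 (`hEmb`) only.  Continues the T⁗-family port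
(`…Lens5TFrame{Currency,…,PDegreeC}`): same namespace `Summit.ResolutionOfSingularities.ResolutionOfSingularities.Theorems.RadicialJungCleanModels.Lens5TFrame`,
declarations VERBATIM; the authors' copies of §B/§B′ (defs) and §C/§D (RG/IR lemmas) are NOT repeated — they are the landed `…Lens5TFrameCurrency` /
`…Lens5TFrameRG` / `…Lens5TFrameIR` declarations of the same names and statements; §C′/§B‴ (unused bridges) and the T′_fin/T′₁/«T″ ⊇ T» corollaries are not ported.
OURS · counted 0 · nothing here proves resolution in characteristic `p`.


-/

set_option linter.dupNamespace false -- mandated namespace of this single-conjunct summit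

noncomputable section

section

open IsLocalRing
open Literature.AlgebraicGeometry.Resolution
open Summit.ResolutionOfSingularities.ResolutionOfSingularities.Theorems.RadicialJung.CleanModels
open Summit.ResolutionOfSingularities.ResolutionOfSingularities.Theorems.RadicialJung.CleanModels.Lens5
open Summit.ResolutionOfSingularities.ResolutionOfSingularities.Theorems.RadicialJung.CleanModels.Lens5.PRankTwoCurrency
open Summit.ResolutionOfSingularities.ResolutionOfSingularities.Theorems.RadicialJung.CleanModels.Lens5.PRankTwoAssembly
open Summit.ResolutionOfSingularities.ResolutionOfSingularities.Theorems.RadicialJungCleanModels.Lens5RegularityCriterion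
open Summit.ResolutionOfSingularities.ResolutionOfSingularities.Theorems.RadicialJungCleanModels.Lens5ChartSurjection

namespace Summit.ResolutionOfSingularities.ResolutionOfSingularities.Theorems.RadicialJungCleanModels.Lens5TFrame

/-- Finite-product sums against the subtype of a `Finset` (bookkeeping). [folklore] -/
theorem sum_product_univ_eq_sum_subtype {S F : Type} [Fintype F] {N : Type} [AddCommMonoid N] (S₀ : Finset S) (g : S × F → N) :
    ∑ l ∈ S₀ ×ˢ (Finset.univ : Finset F), g l = ∑ l : ↥S₀ × F, g ((l.1 : S), l.2) := by
  classical
  rw [Finset.sum_product, Fintype.sum_prod_type, ← Finset.sum_coe_sort]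


/-! ## §D∞ PORT 1′_∞ — the doubly graded data for an ARBITRARY residually `p`-independent `p`-spanning family (new) -/

/-- **`K^p`-linear independence of `1, g₀, …, g₀^{p-1}`** for `g₀ ∉ K^p` (`minpoly_{K^p} g₀ = X^p − g₀^p` has degree `p`). [folklore] -/
theorem pthPowers_linearIndependent_powers {p : ℕ} [Fact p.Prime] {K : Type} [Field K] [CharP K p]
    (g₀ : K) (hg₀ : ∀ c : K, c ^ p ≠ g₀) (ν : Fin p → K) (hν : ∀ i, ν i ∈ (frobenius K p).fieldRange)
    (hsum : ∑ i : Fin p, ν i * g₀ ^ (i : ℕ) = 0) : ∀ i, ν i = 0 := by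
  classical
  have hp : p.Prime := Fact.out
  set Kp : Subfield K := (frobenius K p).fieldRange with hKpdef
  set q : Polynomial Kp := ∑ i : Fin p, Polynomial.C (⟨ν i, hν i⟩ : Kp) * Polynomial.X ^ (i : ℕ) with hqdef
  have hq : Polynomial.aeval g₀ q = 0 := by
    rw [hqdef, map_sum]
    simp only [map_mul, map_pow, Polynomial.aeval_C, Polynomial.aeval_X]
    exact hsum
  by_contra hne
  push Not at hne
  obtain ⟨i₀, hi₀⟩ := hne
  have hcoeff : ∀ i : Fin p, q.coeff i = ⟨ν i, hν i⟩ := by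
    intro i
    rw [hqdef, Polynomial.finsetSum_coeff]
    simp only [Polynomial.coeff_C_mul, Polynomial.coeff_X_pow]
    rw [Finset.sum_eq_single i]
    · simp
    · intro j _ hj
      have : (i : ℕ) ≠ (j : ℕ) := fun h => hj (Fin.ext h).symm
      simp [this]
    · intro h; exact absurd (Finset.mem_univ i) h
  have hq0 : q ≠ 0 := by
    intro h
    have := hcoeff i₀
    rw [h, Polynomial.coeff_zero] at this
    exact hi₀ (by have h' := congrArg Subtype.val this; simpa using h'.symm)
  have hdeg := minpoly.degree_le_of_ne_zero Kp g₀ hq0 hq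
  rw [ImmediateValues.minpoly_eq_X_pow_sub_C g₀ hg₀, Polynomial.degree_X_pow_sub_C hp.pos] at hdeg
  have hlt := Polynomial.degree_sum_fin_lt (fun i : Fin p => (⟨ν i, hν i⟩ : Kp))
  exact absurd (hdeg.trans_lt hlt) (lt_irrefl _)

/-- **PORT 1′_∞ (graded data over a ground field of ARBITRARY `p`-rank with a residually `p`-independent `p`-spanning family).**
`M := K^p(g₀)` with its `p`-th-power values and RG on every FINITE subfamily; `x, y ∈ 𝔪_v` with (P2); generators `t` of `A`; and the
DOUBLE grading on a COMMON FINITE support `S₀ ⊆ S`: every `a ∈ t` is `Σ_{s ∈ S₀,(a,b)} m_{s,ab} B_s x^a y^b` with `m ∈ M` and every piece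
in `O`.  NEW INPUT replacing rev 3's dimension count `[K : M] = |S|·p²` (meaningless for infinite `S`): `k·K^p` IS the `K^p`-span of `B`
(a subfield: `x⁻¹ = (x^p)⁻¹ · x^{p-1}`), the `p³` monomials `g₀^i x^a y^b` are `k·K^p`-linearly independent (by RG + DG on a finite common
support and `K^p`-independence of the powers of `g₀`), hence a `k·K^p`-basis of `K` by (hdeg) `[K : k·K^p] = p³`; expanding the `k·K^p`
coefficients over `B` gives the doubly graded representation.  PROVED. [folklore] -/
theorem port_gradedDataInf (p : ℕ) [Fact p.Prime] {k : Type} [Field k] [CharP k p]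
    {K : Type} [Field K] [CharP K p] [Algebra k K] (O : ValuationSubring K) (A : Subalgebra k K)
    (hAO : A.toSubring ≤ O.toSubring) (hAfg : A.FG)
    (g₀ : K) (hg₀ : ∀ c : K, c ^ p ≠ g₀)
    (hdefect : ∀ f₀ : K, ∃ f₁ : K, O.valuation (g₀ - f₁ ^ p) < O.valuation (g₀ - f₀ ^ p))
    (hP2 : PRankTwoAt p O)
    (hdeg : Module.finrank (Subfield.closure (Set.range (algebraMap k K) ∪ Set.range (frobenius K p))) K = p ^ 3)
    {S : Type} (b : S → k) (hb : IsPSpanningFamilyInf p b)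
    (hPI : ResiduallyPIndependentFamilyInf p O (fun s => algebraMap k K (b s))) :
    ∃ (M : Subfield K), (∀ x : K, x ∈ M ↔ ∃ c : Fin p → K, ∑ j, c j ^ p * g₀ ^ (j : ℕ) = x) ∧ g₀ ∈ M ∧
      (∀ x : K, x ^ p ∈ M) ∧ (∀ m : K, m ∈ M → m ≠ 0 → ∃ w : K, w ≠ 0 ∧ O.valuation m = O.valuation (w ^ p)) ∧
      (∀ (s : Finset S) (c : ↥s → K), (∀ i, c i ∈ M) →
        O.valuation (∑ i : ↥s, c i * algebraMap k K (b i)) = Finset.univ.sup (fun i => O.valuation (c i))) ∧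
      (∀ s, O.valuation (algebraMap k K (b s)) = 1) ∧
      ∃ (x y : K), x ≠ 0 ∧ y ≠ 0 ∧ O.valuation x < 1 ∧ O.valuation y < 1 ∧
        (∀ a b : ℕ, a < p → b < p → (a ≠ 0 ∨ b ≠ 0) → ∀ z : K, z ≠ 0 →
          O.valuation (x ^ a * y ^ b) ≠ O.valuation (z ^ p)) ∧
        ∃ (t : Finset K), Algebra.adjoin k (t : Set K) = A ∧
          ∃ (S₀ : Finset S) (cf : K → S × (Fin p × Fin p) → K), (∀ a ∈ t, ∀ l, cf a l ∈ M) ∧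
            (∀ a ∈ t, ∀ l, l.1 ∉ S₀ → cf a l = 0) ∧
            (∀ a ∈ t, ∑ l ∈ S₀ ×ˢ Finset.univ,
              cf a l * (algebraMap k K (b l.1) * (x ^ (l.2.1 : ℕ) * y ^ (l.2.2 : ℕ))) = a) ∧
            (∀ a ∈ t, ∀ l : S × (Fin p × Fin p),
              cf a l * (algebraMap k K (b l.1) * (x ^ (l.2.1 : ℕ) * y ^ (l.2.2 : ℕ))) ∈ O) := by
  classical
  have hp : p.Prime := Fact.out
  haveI : NeZero p := ⟨hp.ne_zero⟩
  set B : S → K := fun s => algebraMap k K (b s) with hBdef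
  -- ## `M = K^p(g₀)` with its `p`-th-power values (✓ ImmediateValues), IR (§C) and RG on finite subfamilies (§C)
  obtain ⟨M, hM, hg₀M, hpM, hV⟩ := ImmediateValues.exists_subfield_immediate_values (p := p) O.valuation g₀ hdefect
  have hIR : ∀ m : K, m ∈ M → O.valuation m = 1 → ∃ w : K, O.valuation (m - w ^ p) < 1 :=
    fun m hm hvm => immediateResidues_of_noBestApprox O g₀ hdefect M hM m hm hvm
  have hPIs : ∀ s : Finset S, ResiduallyPIndependentFamily p O (fun i : ↥s => B i) :=
    fun s => residuallyPIndependentFamily_restrict O B hPI s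
  have hRG : ∀ (s : Finset S) (c : ↥s → K), (∀ i, c i ∈ M) →
      O.valuation (∑ i : ↥s, c i * B i) = Finset.univ.sup (fun i => O.valuation (c i)) :=
    fun s c hc => valuation_sum_mul_family_eq_sup O M hIR (fun i : ↥s => B i) (hPIs s) c hc
  have hB1 : ∀ s, O.valuation (B s) = 1 := fun s =>
    valuation_eq_one_of_residuallyPIndependentFamily O (fun i : ↥({s} : Finset S) => B i) (hPIs {s})
      ⟨s, Finset.mem_singleton_self s⟩
  have hB0 : ∀ s, B s ≠ 0 := fun s h => by have := hB1 s; rw [h, map_zero] at this; exact zero_ne_one this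
  set Kp : Subfield K := (frobenius K p).fieldRange with hKpdef
  have hKpM : ∀ z : K, z ∈ Kp → z ∈ M := by
    intro z hz
    obtain ⟨u, rfl⟩ := RingHom.mem_fieldRange.mp hz
    rw [frobenius_def]; exact hpM u
  have hpowKp : ∀ z : K, z ^ p ∈ Kp := fun z => RingHom.mem_fieldRange.mpr ⟨z, frobenius_def ..⟩
  -- ## the `K^p`-span of `B` is a subfield containing `k` and `K^p`, hence contains `F₀ = k·K^p`
  set V : Submodule Kp K := Submodule.span Kp (Set.range B) with hVdef
  have hBV : ∀ s, B s ∈ V := fun s => Submodule.subset_span ⟨s, rfl⟩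
  have hkV : ∀ c : k, algebraMap k K c ∈ V := by
    intro c
    obtain ⟨s, d, hd⟩ := hb c
    rw [hd, map_sum]
    refine sum_mem fun u _ => ?_
    rw [map_mul, map_pow]
    have : algebraMap k K (d u) ^ p * B u = (⟨algebraMap k K (d u) ^ p, hpowKp _⟩ : Kp) • B u := by
      rw [Subfield.smul_def, smul_eq_mul]
    rw [this]
    exact V.smul_mem _ (hBV u)
  have hBmulV : ∀ s, ∀ y ∈ V, B s * y ∈ V := by
    intro s y hy
    induction hy using Submodule.span_induction with
    | mem x hx =>
      obtain ⟨t, rfl⟩ := hx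
      have : B s * B t = algebraMap k K (b s * b t) := by rw [map_mul]
      rw [this]; exact hkV _
    | zero => rw [mul_zero]; exact V.zero_mem
    | add x y _ _ hx hy => rw [mul_add]; exact V.add_mem hx hy
    | smul a x _ hx => rw [mul_smul_comm]; exact V.smul_mem a hx
  have hmulV : ∀ x ∈ V, ∀ y ∈ V, x * y ∈ V := by
    intro x hx y hy
    induction hx using Submodule.span_induction with
    | mem x hx' => obtain ⟨s, rfl⟩ := hx'; exact hBmulV s y hy
    | zero => rw [zero_mul]; exact V.zero_mem
    | add x₁ x₂ _ _ h₁ h₂ => rw [add_mul]; exact V.add_mem h₁ h₂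
    | smul a x _ hx => rw [smul_mul_assoc]; exact V.smul_mem a hx
  have h1V : (1 : K) ∈ V := by have := hkV 1; rwa [map_one] at this
  have hpowV : ∀ x ∈ V, ∀ n : ℕ, x ^ n ∈ V := by
    intro x hx n
    induction n with
    | zero => rw [pow_zero]; exact h1V
    | succ n ih => rw [pow_succ]; exact hmulV _ ih _ hx
  have hinvV : ∀ x ∈ V, x⁻¹ ∈ V := by
    intro x hx
    by_cases hx0 : x = 0
    · rw [hx0, inv_zero]; exact V.zero_mem
    have hinvKp : (x ^ p)⁻¹ ∈ Kp := inv_mem (hpowKp x)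
    have heq : x⁻¹ = (⟨(x ^ p)⁻¹, hinvKp⟩ : Kp) • x ^ (p - 1) := by
      rw [Subfield.smul_def, smul_eq_mul]
      change x⁻¹ = (x ^ p)⁻¹ * x ^ (p - 1)
      have hxp : x ^ p = x * x ^ (p - 1) := by
        rw [← pow_succ', Nat.sub_add_cancel hp.one_lt.le]
      rw [hxp, mul_inv, mul_assoc, inv_mul_cancel₀ (pow_ne_zero _ hx0), mul_one]
    rw [heq]
    exact V.smul_mem _ (hpowV x hx _)
  let VF : Subfield K :=
    { carrier := V
      mul_mem' := fun ha hb => hmulV _ ha _ hb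
      one_mem' := h1V
      add_mem' := fun ha hb => V.add_mem ha hb
      zero_mem' := V.zero_mem
      neg_mem' := fun ha => V.neg_mem ha
      inv_mem' := fun x hx => hinvV x hx }
  have hF₀V : Subfield.closure (Set.range (algebraMap k K) ∪ Set.range (frobenius K p)) ≤ VF := by
    apply Subfield.closure_le.mpr
    rintro z (⟨c, rfl⟩ | ⟨u, rfl⟩)
    · exact hkV c
    · change frobenius K p u ∈ V
      have : frobenius K p u = (⟨frobenius K p u, RingHom.mem_fieldRange.mpr ⟨u, rfl⟩⟩ : Kp) • (1 : K) := by
        rw [Subfield.smul_def, smul_eq_mul, mul_one]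
      rw [this]
      exact V.smul_mem _ h1V
  have hF₀repr : ∀ f : K, f ∈ Subfield.closure (Set.range (algebraMap k K) ∪ Set.range (frobenius K p)) →
      ∃ (s : Finset S) (ν : S → K), (∀ i, ν i ∈ Kp) ∧ (∀ i ∉ s, ν i = 0) ∧ f = ∑ i ∈ s, ν i * B i := by
    intro f hf
    have hfV : f ∈ V := hF₀V hf
    obtain ⟨c, hc⟩ := (Finsupp.mem_span_range_iff_exists_finsupp).mp hfV
    refine ⟨c.support, fun i => (c i : K), fun i => (c i).2, fun i hi => ?_, ?_⟩
    · show ((c i : Kp) : K) = 0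
      rw [Finsupp.notMem_support_iff.mp hi]; rfl
    · rw [← hc, Finsupp.sum]
      exact Finset.sum_congr rfl fun i _ => Subfield.smul_def _ _
  -- ## (P2), normalised into the maximal ideal of `O` (as in Port 1)
  obtain ⟨x₀, y₀, hx₀, hy₀, hP₀⟩ := hP2
  obtain ⟨x, hx, hvx, hPx⟩ := exists_pRankTwo_lt_one_left hp O hx₀ hP₀
  obtain ⟨y, hy, hvy, hPy⟩ := exists_pRankTwo_lt_one_left hp O hy₀ (pRankTwo_swap O hPx)
  have hP := pRankTwo_swap O hPy
  -- ## DG on finite subfamilies, `M`-linear independence of `{B_s x^a y^b}` on finite subfamilies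
  set mon : Fin p × Fin p → K := fun ab => x ^ (ab.1 : ℕ) * y ^ (ab.2 : ℕ) with hmon
  have hmon0 : ∀ ab, mon ab ≠ 0 := fun ab => mul_ne_zero (pow_ne_zero _ hx) (pow_ne_zero _ hy)
  have hDG : ∀ (S₀ : Finset S) (m : ↥S₀ × (Fin p × Fin p) → K), (∀ l, m l ∈ M) → ∀ l₀,
      O.valuation (m l₀ * (B (l₀.1 : S) * (x ^ (l₀.2.1 : ℕ) * y ^ (l₀.2.2 : ℕ)))) ≤
        O.valuation (∑ l, m l * (B (l.1 : S) * (x ^ (l.2.1 : ℕ) * y ^ (l.2.2 : ℕ)))) :=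
    fun S₀ m hm l₀ => valuation_term_le_double_sum hp O M hV (fun i : ↥S₀ => B i) (fun i => hB1 i) (hRG S₀) hx hy hP m hm l₀
  have hli : ∀ (S₀ : Finset S) (g : ↥S₀ × (Fin p × Fin p) → K), (∀ l, g l ∈ M) →
      ∑ l, g l * (B (l.1 : S) * (x ^ (l.2.1 : ℕ) * y ^ (l.2.2 : ℕ))) = 0 → ∀ l, g l = 0 := by
    intro S₀ g hg hsum l
    have hle := hDG S₀ g hg l
    rw [hsum, map_zero, le_zero_iff, map_eq_zero] at hle
    rcases mul_eq_zero.mp hle with h1 | h1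
    · exact h1
    · exact absurd h1 (mul_ne_zero (hB0 _) (hmon0 l.2))
  -- ## the `p³` monomials `g₀^i x^a y^b` and the REARRANGEMENT identity
  set mon3 : Fin p × (Fin p × Fin p) → K := fun q => g₀ ^ (q.1 : ℕ) * (x ^ (q.2.1 : ℕ) * y ^ (q.2.2 : ℕ)) with hmon3
  have hREARR : ∀ (νν : Fin p × (Fin p × Fin p) → S → K) (S₀ : Finset S),
      ∑ l ∈ S₀ ×ˢ (Finset.univ : Finset (Fin p × Fin p)),
          (∑ i : Fin p, νν (i, l.2) l.1 * g₀ ^ (i : ℕ)) * (B l.1 * (x ^ (l.2.1 : ℕ) * y ^ (l.2.2 : ℕ))) =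
        ∑ q : Fin p × (Fin p × Fin p), (∑ s ∈ S₀, νν q s * B s) * mon3 q := by
    intro νν S₀
    rw [Finset.sum_product, Fintype.sum_prod_type]
    simp only [Finset.sum_mul, hmon3]
    rw [Finset.sum_comm]
    conv_rhs => rw [Finset.sum_comm]
    refine Finset.sum_congr rfl fun ab _ => ?_
    rw [Finset.sum_comm]
    refine Finset.sum_congr rfl fun i _ => Finset.sum_congr rfl fun s _ => ?_
    ring
  -- ## the `p³` monomials are `F₀`-linearly independent
  set F₀ : Subfield K := Subfield.closure (Set.range (algebraMap k K) ∪ Set.range (frobenius K p)) with hF₀def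
  have hli3 : LinearIndependent F₀ mon3 := by
    rw [Fintype.linearIndependent_iff]
    intro f hf
    have hrep := fun q : Fin p × (Fin p × Fin p) => hF₀repr (f q : K) (f q).2
    choose sq ν hνKp hν0 hνeq using hrep
    set S₀ : Finset S := Finset.univ.biUnion sq with hS₀
    have hsub : ∀ q, sq q ⊆ S₀ := fun q => Finset.subset_biUnion_of_mem sq (Finset.mem_univ q)
    have hν0' : ∀ q s, s ∉ S₀ → ν q s = 0 := fun q s hs => hν0 q s (fun h => hs (hsub q h))
    have hνeq' : ∀ q, (f q : K) = ∑ s ∈ S₀, ν q s * B s := by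
      intro q
      rw [hνeq q]
      exact Finset.sum_subset (hsub q) (fun s _ hs => by rw [hν0 q s hs, zero_mul])
    have h0 : ∑ q, (f q : K) * mon3 q = 0 := by
      have : ∑ q, (f q : K) * mon3 q = ∑ q, f q • mon3 q :=
        Finset.sum_congr rfl fun q _ => (Subfield.smul_def (f q) _).symm
      rw [this, hf]
    -- the vanishing `M`-combination of the `B_s x^a y^b`, `s ∈ S₀`
    set cc : S × (Fin p × Fin p) → K := fun l => ∑ i : Fin p, ν (i, l.2) l.1 * g₀ ^ (i : ℕ) with hcc
    have hccM : ∀ l, cc l ∈ M := fun l => sum_mem fun i _ => mul_mem (hKpM _ (hνKp _ _)) (pow_mem hg₀M _)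
    have hsum0 : ∑ l : ↥S₀ × (Fin p × Fin p),
        cc ((l.1 : S), l.2) * (B (l.1 : S) * (x ^ (l.2.1 : ℕ) * y ^ (l.2.2 : ℕ))) = 0 := by
      rw [← sum_product_univ_eq_sum_subtype S₀
        (fun l : S × (Fin p × Fin p) => cc l * (B l.1 * (x ^ (l.2.1 : ℕ) * y ^ (l.2.2 : ℕ))))]
      rw [hcc, hREARR ν S₀]
      simp only [← hνeq']
      exact h0
    have hcc0 : ∀ s ∈ S₀, ∀ ab, cc (s, ab) = 0 := fun s hs ab =>
      hli S₀ (fun l => cc ((l.1 : S), l.2)) (fun l => hccM _) hsum0 (⟨s, hs⟩, ab)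
    have hνzero : ∀ q s, ν q s = 0 := by
      intro q s
      by_cases hs : s ∈ S₀
      · have h := hcc0 s hs q.2
        have hall := pthPowers_linearIndependent_powers g₀ hg₀ (fun i => ν (i, q.2) s) (fun i => hνKp _ _) h q.1
        simpa only [Prod.mk.eta] using hall
      · exact hν0' q s hs
    intro q
    have hfq : (f q : K) = 0 := by
      rw [hνeq' q]
      exact Finset.sum_eq_zero fun s _ => by rw [hνzero q s, zero_mul]
    exact_mod_cast hfq
  -- ## every `a ∈ K` is an `F₀`-combination of the monomials; expand the coefficients over `B`
  have hN : Module.finrank F₀ K = p ^ 3 := hdeg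
  have hcard3 : Fintype.card (Fin p × (Fin p × Fin p)) = p ^ 3 := by
    simp [Fintype.card_prod, Fintype.card_fin]; ring
  have hrepr3 : ∀ a : K, ∃ f : Fin p × (Fin p × Fin p) → F₀, ∑ q, (f q : K) * mon3 q = a := by
    intro a
    obtain ⟨f, hf⟩ := ImmediateValues.exists_repr_of_linearIndependent_card_eq F₀ hN (pow_pos hp.pos 3) mon3 hli3 hcard3 a
    exact ⟨f, by simpa only [Subfield.smul_def, smul_eq_mul] using hf⟩
  obtain ⟨t, ht⟩ := hAfg
  choose f3 hf3 using hrepr3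
  have hrep := fun (a : K) (q : Fin p × (Fin p × Fin p)) => hF₀repr (f3 a q : K) (f3 a q).2
  choose sq ν hνKp hν0 hνeq using hrep
  set S₀ : Finset S := (t ×ˢ (Finset.univ : Finset (Fin p × (Fin p × Fin p)))).biUnion (fun aq => sq aq.1 aq.2) with hS₀
  have hsub : ∀ a ∈ t, ∀ q, sq a q ⊆ S₀ := fun a ha q =>
    Finset.subset_biUnion_of_mem (fun aq : K × (Fin p × (Fin p × Fin p)) => sq aq.1 aq.2) (x := (a, q))
      (Finset.mem_product.mpr ⟨ha, Finset.mem_univ q⟩)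
  set cf : K → S × (Fin p × Fin p) → K := fun a l => ∑ i : Fin p, ν a (i, l.2) l.1 * g₀ ^ (i : ℕ) with hcf
  have hcfM : ∀ a l, cf a l ∈ M := fun a l => sum_mem fun i _ => mul_mem (hKpM _ (hνKp _ _ _)) (pow_mem hg₀M _)
  have hcf0 : ∀ a ∈ t, ∀ l : S × (Fin p × Fin p), l.1 ∉ S₀ → cf a l = 0 := by
    intro a ha l hl
    refine Finset.sum_eq_zero fun i _ => ?_
    rw [hν0 a (i, l.2) l.1 (fun h => hl (hsub a ha _ h)), zero_mul]
  have hsumcf : ∀ a ∈ t, ∑ l ∈ S₀ ×ˢ Finset.univ, cf a l * (B l.1 * (x ^ (l.2.1 : ℕ) * y ^ (l.2.2 : ℕ))) = a := by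
    intro a ha
    have hνeq' : ∀ q, (f3 a q : K) = ∑ s ∈ S₀, ν a q s * B s := fun q => by
      rw [hνeq a q]
      exact Finset.sum_subset (hsub a ha q) (fun s _ hs => by rw [hν0 a q s hs, zero_mul])
    rw [hcf, hREARR (ν a) S₀]
    simp only [← hνeq']
    exact hf3 a
  refine ⟨M, hM, hg₀M, hpM, hV, hRG, hB1, x, y, hx, hy, hvx, hvy, hP, t, ht, S₀, cf, fun a _ l => hcfM a l, hcf0, hsumcf, ?_⟩
  intro a ha l
  by_cases hl : l.1 ∈ S₀
  · have haA : a ∈ A := by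
      rw [← ht]
      exact Algebra.subset_adjoin (Finset.mem_coe.mpr ha)
    have hva : O.valuation a ≤ 1 := (O.valuation_le_one_iff a).mpr (hAO haA)
    have hterm := hDG S₀ (fun l' => cf a ((l'.1 : S), l'.2)) (fun l' => hcfM _ _) (⟨l.1, hl⟩, l.2)
    rw [← sum_product_univ_eq_sum_subtype S₀
      (fun l : S × (Fin p × Fin p) => cf a l * (B l.1 * (x ^ (l.2.1 : ℕ) * y ^ (l.2.2 : ℕ)))), hsumcf a ha] at hterm
    exact (O.valuation_le_one_iff _).mp (hterm.trans hva)
  · rw [hcf0 a ha l hl, zero_mul]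
    exact O.zero_mem

end Summit.ResolutionOfSingularities.ResolutionOfSingularities.Theorems.RadicialJungCleanModels.Lens5TFrame

end
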